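import Mathlib
import Summits.NavierStokesRegularity.NavierStokesRegularity.Theorems.TaoLadderRungTwoFlatExistTubeGlue
import Summits.NavierStokesRegularity.NavierStokesRegularity.Theorems.TaoLadderRungTwoFlatTubeExistReduction
import HarnessLib

/-!
# K4 ASSEMBLED: the existence clause `TubeExistWith` of the tube frame on the whole clock window `[0, c]`, BY PHASE, from the
  short-horizon a-priori bounds (capture type: uniform; tube type: uniform below caps), the landing data of every hop and an admissible weight
  (helper for the K_A♭ parent item stmt-NavierStokesRegularity-22987 `FlatGapCertificatesV2`, child 2A `GradedAdiabaticWakeA` of route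
  TaoLadderRungTwoFlat; cell harvest/h2-tao-ladder, p1 g25; LADDER §47.5 L2, §50 (`TubeExist`, K4))

`tubeExistWith_of_apriori` (p729549) ⟸ per hop `n` the all-horizon `hapr` clause ⟸ (`apriori_extend_of_landing`, p731616) the
short-horizon bound at hop `n`, the landing data at hop `n`, and the UNIFORM short-horizon bound at hop `n+1`. The short-horizon bounds come
by phase: CAPTURE TYPE at hops `n ≤ N₀` (`apriori_capture_of_continuity`, p730001: one bound for all states of the hop), TUBE TYPE at hops
`n > N₀` (`apriori_tube_uniform`: one bound for all tube states below given caps; the caps of a landing state are read off the previous hop's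
bound inside `apriori_extend_of_landing`). This module wires the phases:

* `landingData_of_obligations` — the landing data of a hop (`τ₁ ∈ [t_lo, c₀]`, `a ∈ [f, a_max]`, `recentre S τ₁ a ∈ H(n+1)`) from the CLOCK
  obligation, the CAPTURE (`n+1 ≤ N₀`) / LANDING (`N₀ ≤ n`) obligation, and the two rows `t_lo ≤ τ₁`, `a ≤ a_max`;
* `tubeExistWith_of_phases` — **`TubeExistWith P Bcl S♭ ε₀ i₀ T♭(ε) X₀ w r ζ u⋆ c`** from: capture-type bounds at `n ≤ N₀`, tube-type uniform
  bounds and per-state caps at `n > N₀`, landing data at every hop, an admissible Banach weight `ω` (ratios `Λ_ω`, floor `ω_min` behind), and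
  the window arithmetic `(c − t_lo)·a_max·(1+ε₀)^{5/2} ≤ c₀`.

HONEST FRAMING: composition (soft analysis) over the cell's typed induction frame (MODEL lattice, graded mirror table on `S♭`); the short-horizon
bounds' own inputs (reference flows, zone levels, rows) remain HYPOTHESES upstream; nothing certified; no item closed; nothing about the
Navier–Stokes equations.
-/

noncomputable section

-- the sub-problem namespace repeats the summit name by design (D-0017)
set_option linter.dupNamespace false

namespace Summit.NavierStokesRegularity.NavierStokesRegularity.Theorems.HopTube

open Set Finset Literature.Analysis.FluidPDE Literature.Analysis.FluidPDE.TaoCascade MirrorPulse RenormFrame QuadPolar GappedFrontRobustOn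

section Final

variable {ε ε₀ : ℝ}

/-- **Landing data of a hop from its obligations**: the clock obligation (`0 < τ₁ ≤ c₀`, `(1+ε₀)^{−θ₀} ≤ a`), the capture (`n+1 ≤ N₀`) or
landing (`N₀ ≤ n`) obligation (the re-centred state is in `H(n+1)`), and the rows `t_lo ≤ τ₁`, `a ≤ a_max` along premises.
[cite: Tao2016AveragedNS, §6.4 Prop. 6.5 (statement shape); route TaoLadderRungTwoFlat, `HopTube.stepToWith_of_obligations` (cell LADDER §50)] -/
theorem landingData_of_obligations (P : TubeSchedule) {Bcl : ℕ → (Fin 2 → ℤ → ℝ) → Prop} (rule : HopRule)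
    {𝕊 : Finset (ℤ × ℤ × ℤ)} {σ : ℝ} {i₀ : Fin 2} {α : Fin 2 → Fin 2 → Fin 2 → ℤ × ℤ × ℤ → ℝ} {X₀ : Fin 2 → ℝ} {w : ℤ → ℝ}
    {r θ₀ c₀ tlo amax : ℝ} {ζ : ℕ → Fin 2 → ℤ → ℝ} {ustar : Fin 2 → ℤ → ℝ} {n : ℕ}
    (hclock : TubeStepClockWith P Bcl rule 𝕊 σ ε₀ i₀ α X₀ w r θ₀ c₀ ζ ustar n)
    (hcap : n + 1 ≤ P.N₀ → TubeStepCaptureWith P Bcl rule 𝕊 ε₀ i₀ α X₀ w r c₀ ζ ustar n)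
    (hland : P.N₀ ≤ n → TubeStepLandWith P Bcl rule 𝕊 ε₀ i₀ α X₀ w r c₀ ζ ustar n)
    (hτlo : ∀ z S₀ τ S F, HopPremiseWith P Bcl 𝕊 ε₀ i₀ α X₀ w r c₀ ζ ustar n z S₀ τ S F → tlo ≤ rule.τ₁ n S)
    (hamax : ∀ z S₀ τ S F, HopPremiseWith P Bcl 𝕊 ε₀ i₀ α X₀ w r c₀ ζ ustar n z S₀ τ S F → rule.a n S ≤ amax) :
    ∀ z S₀ τ S F, HopPremiseWith P Bcl 𝕊 ε₀ i₀ α X₀ w r c₀ ζ ustar n z S₀ τ S F →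
      tlo ≤ rule.τ₁ n S ∧ rule.τ₁ n S ≤ c₀ ∧ (1 + ε₀) ^ (-θ₀) ≤ rule.a n S ∧ rule.a n S ≤ amax ∧
        InTubeWith P Bcl i₀ X₀ w r ζ ustar (n + 1) (recentre S (rule.τ₁ n S) (rule.a n S)) := by
  intro z S₀ τ S F h
  obtain ⟨-, h2, -, h4, -, -⟩ := hclock z S₀ τ S F h
  refine ⟨hτlo z S₀ τ S F h, h2, h4, hamax z S₀ τ S F h, ?_⟩
  by_cases hn : n + 1 ≤ P.N₀
  · have hc := hcap hn z S₀ τ S F h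
    simp only [InTubeWith, Nat.succ_ne_zero, if_false, if_pos hn]
    exact hc
  · have hl := hland (by omega) z S₀ τ S F h
    simp only [InTubeWith, Nat.succ_ne_zero, if_false, if_neg hn]
    exact hl

/-- **K4 ASSEMBLED, BY PHASE.** See the module docstring. [cite: Tao2016AveragedNS, §4 Lemma 4.1 (4.5), (4.8)–(4.10), (4.12); Teschl2012, Cor. 2.16; route TaoLadderRungTwoFlat, `HopTube.TubeExistWith` (cell LADDER §47.5 L2, K4)] -/
theorem tubeExistWith_of_phases (P : TubeSchedule) {Bcl : ℕ → (Fin 2 → ℤ → ℝ) → Prop} (rule : HopRule) {i₀ : Fin 2}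
    {X₀ : Fin 2 → ℝ} {w ω : ℤ → ℝ} {r c₀ c A Mα Dω : ℝ} {ζ : ℕ → Fin 2 → ℤ → ℝ} {ustar : Fin 2 → ℤ → ℝ}
    (hε₀ : 0 < ε₀) (hc₀ : 0 < c₀) (hc : 0 < c) (hr0 : 0 ≤ r)
    -- the Banach weight
    (hω : WeightRatiosLEOn shiftSetFlat ε₀ ω A) (hA : 0 ≤ A) (hMα : 0 ≤ Mα)
    (hα : ∀ i₁ i₂ i₃ μ, |mirrorTable ε ε i₁ i₂ i₃ μ| ≤ Mα) (hD : ∀ k : ℤ, (1 + (1 + ε₀) ^ ((10 : ℝ) * k)) / ω k ≤ Dω)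
    {f amax tlo ωmin Λω : ℝ} (hf : 0 < f) (hamax : 0 < amax) (htlo : 0 < tlo)
    (hcrange : (c - tlo) * amax * (1 + ε₀) ^ ((5 : ℝ) / 2) ≤ c₀)
    (hωmin0 : 0 < ωmin) (hωmin : ∀ k : ℤ, k ≤ -(P.K : ℤ) → ωmin ≤ ω k)
    (hΛω : 0 ≤ Λω) (hωdown : ∀ k : ℤ, ω k ≤ Λω * ω (k + 1)) (hωup : ∀ k : ℤ, ω k ≤ Λω * ω (k - 1))
    -- landing data at every hop
    (hlanding : ∀ n z S₀ τ S F, HopPremiseWith P Bcl shiftSetFlat ε₀ i₀ (mirrorTable ε ε) X₀ w r c₀ ζ ustar n z S₀ τ S F →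
      tlo ≤ rule.τ₁ n S ∧ rule.τ₁ n S ≤ c₀ ∧ f ≤ rule.a n S ∧ rule.a n S ≤ amax ∧
        InTubeWith P Bcl i₀ X₀ w r ζ ustar (n + 1) (recentre S (rule.τ₁ n S) (rule.a n S)))
    -- CAPTURE-type short-horizon bounds at hops `n ≤ N₀` (uniform over the hop's states)
    (hcapB : ∀ n, n ≤ P.N₀ → ∃ Bn : ℝ, ∀ z S₀ : Fin 2 → ℤ → ℝ, InTubeWith P Bcl i₀ X₀ w r ζ ustar n z →
      (∀ i k, w k * |S₀ i k - z i k| ≤ r) →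
        (∀ (i : Fin 2) (k : ℤ), ω k * |S₀ i k| ≤ Bn) ∧
          ∀ s : ℝ, 0 < s → s ≤ c₀ → ∀ S F : Fin 2 → ℤ → ℝ → ℝ,
            PseudoFlowOnShift shiftSetFlat s ε₀ (mirrorTable ε ε) 0 0 S₀ (fun i k => (1 / 2) * S₀ i k ^ 2) (fun _ _ => 0) S F →
              ∀ t ∈ Icc 0 s, ∀ (i : Fin 2) (k : ℤ), ω k * |S i k t| ≤ Bn)
    -- TUBE-type short-horizon bounds at hops `n > N₀` (uniform below caps), and the caps of every tube state
    (htubeB : ∀ n, P.N₀ < n → ∀ Λb Bz : ℝ, 0 ≤ Λb → ∃ B : ℝ, ∀ z S₀ : Fin 2 → ℤ → ℝ, InTubeWith P Bcl i₀ X₀ w r ζ ustar n z →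
      (∀ (i : Fin 2) (k : ℤ), k < -(P.K : ℤ) → |z i k| ≤ Λb) → (∀ i k, ω k * |z i k| ≤ Bz) → (∀ i k, w k * |S₀ i k - z i k| ≤ r) →
        (∀ (i : Fin 2) (k : ℤ), ω k * |S₀ i k| ≤ B) ∧
          ∀ s : ℝ, 0 < s → s ≤ c₀ → ∀ S F : Fin 2 → ℤ → ℝ → ℝ,
            PseudoFlowOnShift shiftSetFlat s ε₀ (mirrorTable ε ε) 0 0 S₀ (fun i k => (1 / 2) * S₀ i k ^ 2) (fun _ _ => 0) S F →
              ∀ t ∈ Icc 0 s, ∀ (i : Fin 2) (k : ℤ), ω k * |S i k t| ≤ B)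
    (hcaps : ∀ n, P.N₀ < n → ∀ z, InTubeWith P Bcl i₀ X₀ w r ζ ustar n z →
      ∃ Λb Bz : ℝ, 0 ≤ Λb ∧ (∀ (i : Fin 2) (k : ℤ), k < -(P.K : ℤ) → |z i k| ≤ Λb) ∧ (∀ i k, ω k * |z i k| ≤ Bz)) :
    TubeExistWith P Bcl shiftSetFlat ε₀ i₀ (mirrorTable ε ε) X₀ w r ζ ustar c := by
  have hε : 0 ≤ 1 + ε₀ := by linarith
  have hω0 : ∀ k, 0 ≤ ω k := fun k => (hω.1 k).le
  have hkick0 : ∀ y : Fin 2 → ℤ → ℝ, ∀ (i : Fin 2) (k : ℤ), w k * |y i k - y i k| ≤ r := fun y i k => by simp [hr0]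
  -- the uniform "next hop" bound at hop `m`, from whichever phase `m` is in
  have hnext : ∀ m : ℕ, ∀ Λb Bz : ℝ, 0 ≤ Λb → ∃ B' : ℝ, ∀ y : Fin 2 → ℤ → ℝ, InTubeWith P Bcl i₀ X₀ w r ζ ustar m y →
      (∀ (i : Fin 2) (k : ℤ), k < -(P.K : ℤ) → |y i k| ≤ Λb) → (∀ (i : Fin 2) (k : ℤ), ω k * |y i k| ≤ Bz) →
        ∀ s' : ℝ, 0 < s' → s' ≤ c₀ → ∀ Y FY : Fin 2 → ℤ → ℝ → ℝ,
          PseudoFlowOnShift shiftSetFlat s' ε₀ (mirrorTable ε ε) 0 0 y (fun i k => (1 / 2) * y i k ^ 2) (fun _ _ => 0) Y FY →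
            ∀ u ∈ Icc 0 s', ∀ (i : Fin 2) (k : ℤ), ω k * |Y i k u| ≤ B' := by
    intro m Λb Bz hΛb
    rcases le_or_gt m P.N₀ with hm | hm
    · obtain ⟨Bm, hBm⟩ := hcapB m hm
      exact ⟨Bm, fun y hy _ _ s' hs' hs'c Y FY hY => (hBm y y hy (hkick0 y)).2 s' hs' hs'c Y FY hY⟩
    · obtain ⟨Bm, hBm⟩ := htubeB m hm Λb Bz hΛb
      exact ⟨Bm, fun y hy hc1 hc2 s' hs' hs'c Y FY hY => (hBm y y hy hc1 hc2 (hkick0 y)).2 s' hs' hs'c Y FY hY⟩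
  refine tubeExistWith_of_apriori P hε hω hA hMα hα hD hc fun n z S₀ hz hkick => ?_
  -- the short-horizon bound at hop `n` for this state
  have hshort : ∀ z' S₀' : Fin 2 → ℤ → ℝ, InTubeWith P Bcl i₀ X₀ w r ζ ustar n z' → (∀ i k, w k * |S₀' i k - z' i k| ≤ r) →
      ∃ B : ℝ, (∀ (i : Fin 2) (k : ℤ), ω k * |S₀' i k| ≤ B) ∧
        ∀ s : ℝ, 0 < s → s ≤ c₀ → ∀ S F : Fin 2 → ℤ → ℝ → ℝ,
          PseudoFlowOnShift shiftSetFlat s ε₀ (mirrorTable ε ε) 0 0 S₀' (fun i k => (1 / 2) * S₀' i k ^ 2) (fun _ _ => 0) S F →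
            ∀ t ∈ Icc 0 s, ∀ (i : Fin 2) (k : ℤ), ω k * |S i k t| ≤ B := by
    intro z' S₀' hz' hkick'
    rcases le_or_gt n P.N₀ with hn | hn
    · obtain ⟨Bn, hBn⟩ := hcapB n hn
      exact ⟨Bn, hBn z' S₀' hz' hkick'⟩
    · obtain ⟨Λb, Bz, hΛb, hc1, hc2⟩ := hcaps n hn z' hz'
      obtain ⟨Bn, hBn⟩ := htubeB n hn Λb Bz hΛb
      exact ⟨Bn, hBn z' S₀' hz' hc1 hc2 hkick'⟩
  exact apriori_extend_of_landing (rule := rule) P hε₀ hc₀ hf hamax htlo hcrange hω0 hωmin0 hωmin hΛω hωdown hωup hshort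
    (hlanding n) (hnext (n + 1)) hz hkick

end Final

end Summit.NavierStokesRegularity.NavierStokesRegularity.Theorems.HopTube

end
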